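import Literature.AlgebraicGeometry.Motives.HodgeLieWeilClassesObstruction
import Literature.AlgebraicGeometry.Motives.HodgeLieTimesGluedBlocks
import HarnessLib

/-!
# `𝔥(H₁ ⊕ H₂) ⊊ 𝔥(H₁) × 𝔥(H₂)` when a quadratic field acts on both summands with Weil-type total signature and `H₂` has `E`-rank one
# (Moonen–Zarhin 1999 Thm. 0.1 (4)(a): `E × T`, `E` a CM elliptic curve whose field embeds into `End⁰T` — the Weil classes of `E × T`)

Family `hodge`, layer `Literature/AlgebraicGeometry/Motives`; THEOREMS ONLY (no definition, no named fact).  Written for the cell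
`pub-hodgecm2` (COR-CM), seat `b27` gen 48 (count-neutral Mumford–Tate-rank ladder: the SAME-FIELD cell `E_k × T`, `k ⊂ End⁰T`).
Sequel of `Motives/HodgeLieWeilClassesObstruction` (an operator whose derivation scales the Weil lines by non-zero scalars is not in `𝔥`)
and the converse companion of `Motives/HodgeLieTimesCMCurve` (different fields ⟹ `𝔥(H₁ ⊕ H₂) = 𝔥(H₁) × 𝔥(H₂)`).

SETTING.  `H ≅ H₁ ⊕ H₂` effective weight-one `ℚ`-Hodge structures (morphisms `ι_i`, `π_i`, `π_i ι_i = id`, `ι₁π₁ + ι₂π₂ = id`);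
a quadratic number field `E` acting on `H₁`, `H₂`, `H` by Hodge endomorphisms (`A₁`, `A₂`, `A : EndAction`) COMPATIBLY
(`A.ι e ∘ ι_i = ι_i ∘ A_i.ι e`, so `A.ι e = ι₁ A₁(e) π₁ + ι₂ A₂(e) π₂`: the diagonal action); `dim_ℚ V₂ = 2` (`H₂` = `H¹` of an elliptic
curve with complex multiplication by `E`, `E`-rank one).

RESULTS.
* §1 bookkeeping: `ι_apply_eq_sum` (`A.ι e = Σ ι_i A_i(e) π_i`), `mem_iInf_eigenspace_sum_iff`, `mem_piece_sum_iff` (eigenspaces and Hodge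
  pieces of `H` are tested blockwise) ⟹ **`finrank_iInf_eigenspace_sum`**, **`multiplicity_sum`**:
  `dim V_{ℂ,σ} = dim V_{1,ℂ,σ} + dim V_{2,ℂ,σ}`, `n_σ(H) = n_σ(H₁) + n_σ(H₂)`.
* §2 **`weilLine_le_eigenspace_derivation_corner`** — for `X = ι₂ A₂(e₀) π₂` («`e₀` on `H₂`, `0` on `H₁`») the Weil line `⋀ᵈ V_{ℂ,σ}`
  (`d = dim V_{ℂ,σ}`) lies in the `σ(e₀)`-eigenspace of `D_{X_ℂ}` (a basis of `V_{ℂ,σ}`: one vector of `ι₂ V_{2,ℂ,σ}` — eigenvalue `σ e₀` — and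
  `d − 1` vectors of `ι₁ V_{1,ℂ,σ}` — eigenvalue `0`).
* §3 **`corner_not_mem_hodgeLie_of_weilType`** — if the TOTAL action is of Weil type (`2(n_σ(H₁) + n_σ(H₂)) = dim_ℚ V / 2` for both `σ`)
  and `e₀ ≠ 0`, then `ι₂ A₂(e₀) π₂ ∉ 𝔥(H)`; **`finrank_hodgeLie_lt_add_of_weilType`** — if moreover `A₂(e₀) ∈ 𝔥(H₂)` then
  `dim 𝔥(H) < dim 𝔥(H₁) + dim 𝔥(H₂)` (the block map `𝔥(H) ↪ 𝔥(H₁) × 𝔥(H₂)` misses `(0, A₂(e₀))`): «`Hg(X) ≠ Hg(X₁) × Hg(X₂)`», the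
  Weil classes `⋀ᵈ_E(H₁ ⊕ H₂)` being Hodge classes moved by `Hg(H₁) × Hg(H₂)`.
AV reading (`CorCM/MumfordTateRankTimesCMCurveSameField`): `T` a simple abelian threefold with `End⁰T = ℚ(√−d)` (multiplicities `(2,1)`),
`E` an elliptic curve with `End⁰E ≅ End⁰T`: `dim MT(H¹(E × T)) = 10 < 11`.

## References
* [MoonenZarhin1999LowDim] B. Moonen, Yu. G. Zarhin, Math. Ann. 315 (1999), Thm. 0.1 (4)(a), Thm. (0.2) (1), §3 (3.1), Lemma (3.6), Prop. (3.8)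
  [corpus: paper:arxiv-math_9901113 pp. 1–2, 6–7]. [cite: MoonenZarhin1999LowDim, Thm. 0.1 (4) and §3 (3.1)]
* [Deligne1982HodgeCycles] P. Deligne, LNM 900 (1982), I §3.1, Prop. 3.4; §4 Prop. 4.4. [cite: Deligne1982HodgeCycles, §4 Prop. 4.4]
-/

noncomputable section

open scoped TensorProduct

namespace Literature.AlgebraicGeometry.Motives

namespace HodgeStructure

universe u

variable {V₁ : Type u} [AddCommGroup V₁] [Module ℚ V₁] [Module.Finite ℚ V₁]
  {V₂ : Type u} [AddCommGroup V₂] [Module ℚ V₂] [Module.Finite ℚ V₂]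
  {V : Type u} [AddCommGroup V] [Module ℚ V] [Module.Finite ℚ V] [HodgeTensorFacts.{u, u}]

section General

variable {n : ℤ} {H₁ : HodgeStructure V₁ n} {H₂ : HodgeStructure V₂ n} {H : HodgeStructure V n}
  (ι₁ : Hom H₁ H) (π₁ : Hom H H₁) (ι₂ : Hom H₂ H) (π₂ : Hom H H₂)
  (hπι₁ : ∀ v, π₁.toLinearMap (ι₁.toLinearMap v) = v) (hπι₂ : ∀ v, π₂.toLinearMap (ι₂.toLinearMap v) = v)
  (hsum : ∀ v, ι₁.toLinearMap (π₁.toLinearMap v) + ι₂.toLinearMap (π₂.toLinearMap v) = v)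
  {E : Type*} [Field E] [NumberField E] (A₁ : EndAction H₁ E) (A₂ : EndAction H₂ E) (A : EndAction H E)
  (hA₁ : ∀ e, A.ι e ∘ₗ ι₁.toLinearMap = ι₁.toLinearMap ∘ₗ A₁.ι e) (hA₂ : ∀ e, A.ι e ∘ₗ ι₂.toLinearMap = ι₂.toLinearMap ∘ₗ A₂.ι e)

/-! ## §1 The diagonal action: eigenspaces and Hodge pieces blockwise, multiplicities add -/

omit [Module.Finite ℚ V₁] [Module.Finite ℚ V₂] [Module.Finite ℚ V] [HodgeTensorFacts.{u, u}] in
include hπι₁ hπι₂ hsum in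
/-- `π₂ ι₁ = 0`. [folklore] -/
private theorem proj₂_incl₁_eq_zero_w (v : V₁) : π₂.toLinearMap (ι₁.toLinearMap v) = 0 := by
  have h := congrArg π₂.toLinearMap (hsum (ι₁.toLinearMap v))
  rw [map_add, hπι₁ v, hπι₂] at h
  exact add_eq_left.1 h

omit [Module.Finite ℚ V₁] [Module.Finite ℚ V₂] [Module.Finite ℚ V] [HodgeTensorFacts.{u, u}] in
include hπι₁ hπι₂ hsum in
/-- `π₁ ι₂ = 0`. [folklore] -/
private theorem proj₁_incl₂_eq_zero_w (v : V₂) : π₁.toLinearMap (ι₂.toLinearMap v) = 0 := by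
  have h := congrArg π₁.toLinearMap (hsum (ι₂.toLinearMap v))
  rw [map_add, hπι₂ v, hπι₁] at h
  exact add_eq_left.1 h

omit [Module.Finite ℚ V₁] [Module.Finite ℚ V₂] [Module.Finite ℚ V] [HodgeTensorFacts.{u, u}] in
include hsum in
/-- Complexified decomposition `x = ι₁,ℂ π₁,ℂ x + ι₂,ℂ π₂,ℂ x`. [folklore] -/
private theorem sum_baseChange (x : ℂ ⊗[ℚ] V) :
    ι₁.toLinearMap.baseChange ℂ (π₁.toLinearMap.baseChange ℂ x) + ι₂.toLinearMap.baseChange ℂ (π₂.toLinearMap.baseChange ℂ x) = x := by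
  have h : ι₁.toLinearMap ∘ₗ π₁.toLinearMap + ι₂.toLinearMap ∘ₗ π₂.toLinearMap = LinearMap.id := LinearMap.ext hsum
  have h' := congrArg (fun f : V →ₗ[ℚ] V => f.baseChange ℂ x) h
  simp only [LinearMap.baseChange_add, LinearMap.add_apply, LinearMap.baseChange_comp, LinearMap.comp_apply,
    LinearMap.baseChange_id, LinearMap.id_apply] at h'
  exact h'

omit [Module.Finite ℚ V₁] [Module.Finite ℚ V₂] [Module.Finite ℚ V] [HodgeTensorFacts.{u, u}] in
include hsum hA₁ hA₂ in
/-- **The action on `H` is diagonal: `A.ι e = ι₁ A₁(e) π₁ + ι₂ A₂(e) π₂`.** [cite: MoonenZarhin1999LowDim, §3 (3.1)] -/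
theorem ι_apply_eq_sum (e : E) (v : V) :
    A.ι e v = ι₁.toLinearMap (A₁.ι e (π₁.toLinearMap v)) + ι₂.toLinearMap (A₂.ι e (π₂.toLinearMap v)) := by
  conv_lhs => rw [← hsum v]
  rw [map_add, ← LinearMap.comp_apply (f := A.ι e), hA₁ e, ← LinearMap.comp_apply (f := A.ι e), hA₂ e]
  rfl

omit [Module.Finite ℚ V₁] [Module.Finite ℚ V₂] [Module.Finite ℚ V] [HodgeTensorFacts.{u, u}] in
include hπι₁ hπι₂ hsum hA₁ hA₂ in
/-- `π₁ ∘ A.ι e = A₁.ι e ∘ π₁`. [folklore] -/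
private theorem proj₁_ι (e : E) (v : V) : π₁.toLinearMap (A.ι e v) = A₁.ι e (π₁.toLinearMap v) := by
  rw [ι_apply_eq_sum ι₁ π₁ ι₂ π₂ hsum A₁ A₂ A hA₁ hA₂, map_add, hπι₁, proj₁_incl₂_eq_zero_w ι₁ π₁ ι₂ π₂ hπι₁ hπι₂ hsum, add_zero]

omit [Module.Finite ℚ V₁] [Module.Finite ℚ V₂] [Module.Finite ℚ V] [HodgeTensorFacts.{u, u}] in
include hπι₁ hπι₂ hsum hA₁ hA₂ in
/-- `π₂ ∘ A.ι e = A₂.ι e ∘ π₂`. [folklore] -/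
private theorem proj₂_ι (e : E) (v : V) : π₂.toLinearMap (A.ι e v) = A₂.ι e (π₂.toLinearMap v) := by
  rw [ι_apply_eq_sum ι₁ π₁ ι₂ π₂ hsum A₁ A₂ A hA₁ hA₂, map_add, hπι₂, proj₂_incl₁_eq_zero_w ι₁ π₁ ι₂ π₂ hπι₁ hπι₂ hsum, zero_add]

omit [Module.Finite ℚ V₁] [Module.Finite ℚ V₂] [Module.Finite ℚ V] [HodgeTensorFacts.{u, u}] in
include hπι₁ hπι₂ hsum hA₁ hA₂ in
/-- **Joint eigenspaces blockwise**: `x ∈ V_{ℂ,σ}` iff `π₁,ℂ x ∈ V_{1,ℂ,σ}` and `π₂,ℂ x ∈ V_{2,ℂ,σ}`.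
[cite: Deligne1982HodgeCycles, §4 Prop. 4.4] -/
theorem mem_iInf_eigenspace_sum_iff (σ : E →+* ℂ) (x : ℂ ⊗[ℚ] V) :
    x ∈ (⨅ e, Module.End.eigenspace ((A.ι e).baseChange ℂ) (σ e)) ↔
      π₁.toLinearMap.baseChange ℂ x ∈ (⨅ e, Module.End.eigenspace ((A₁.ι e).baseChange ℂ) (σ e)) ∧
        π₂.toLinearMap.baseChange ℂ x ∈ (⨅ e, Module.End.eigenspace ((A₂.ι e).baseChange ℂ) (σ e)) := by
  have hc₁ : ∀ e, π₁.toLinearMap.baseChange ℂ ∘ₗ (A.ι e).baseChange ℂ = (A₁.ι e).baseChange ℂ ∘ₗ π₁.toLinearMap.baseChange ℂ :=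
    fun e => by
      rw [← LinearMap.baseChange_comp, ← LinearMap.baseChange_comp]
      exact congrArg _ (LinearMap.ext (proj₁_ι ι₁ π₁ ι₂ π₂ hπι₁ hπι₂ hsum A₁ A₂ A hA₁ hA₂ e))
  have hc₂ : ∀ e, π₂.toLinearMap.baseChange ℂ ∘ₗ (A.ι e).baseChange ℂ = (A₂.ι e).baseChange ℂ ∘ₗ π₂.toLinearMap.baseChange ℂ :=
    fun e => by
      rw [← LinearMap.baseChange_comp, ← LinearMap.baseChange_comp]
      exact congrArg _ (LinearMap.ext (proj₂_ι ι₁ π₁ ι₂ π₂ hπι₁ hπι₂ hsum A₁ A₂ A hA₁ hA₂ e))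
  have hi₁ : ∀ e, (A.ι e).baseChange ℂ ∘ₗ ι₁.toLinearMap.baseChange ℂ = ι₁.toLinearMap.baseChange ℂ ∘ₗ (A₁.ι e).baseChange ℂ :=
    fun e => by rw [← LinearMap.baseChange_comp, ← LinearMap.baseChange_comp, hA₁ e]
  have hi₂ : ∀ e, (A.ι e).baseChange ℂ ∘ₗ ι₂.toLinearMap.baseChange ℂ = ι₂.toLinearMap.baseChange ℂ ∘ₗ (A₂.ι e).baseChange ℂ :=
    fun e => by rw [← LinearMap.baseChange_comp, ← LinearMap.baseChange_comp, hA₂ e]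
  simp only [Submodule.mem_iInf, Module.End.mem_eigenspace_iff]
  constructor
  · intro hx
    refine ⟨fun e => ?_, fun e => ?_⟩
    · rw [← LinearMap.comp_apply, ← hc₁ e, LinearMap.comp_apply, hx e, map_smul]
    · rw [← LinearMap.comp_apply, ← hc₂ e, LinearMap.comp_apply, hx e, map_smul]
  · rintro ⟨h₁, h₂⟩ e
    conv_lhs => rw [← sum_baseChange ι₁ π₁ ι₂ π₂ hsum x]
    rw [map_add, ← LinearMap.comp_apply, hi₁ e, LinearMap.comp_apply, h₁ e, ← LinearMap.comp_apply, hi₂ e, LinearMap.comp_apply,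
      h₂ e, map_smul, map_smul, ← smul_add, sum_baseChange ι₁ π₁ ι₂ π₂ hsum x]

omit [Module.Finite ℚ V₁] [Module.Finite ℚ V₂] [Module.Finite ℚ V] [HodgeTensorFacts.{u, u}] in
include hsum in
/-- **Hodge pieces blockwise**: `x ∈ H^{p,q}` iff `π₁,ℂ x ∈ H₁^{p,q}` and `π₂,ℂ x ∈ H₂^{p,q}` (morphisms map pieces to pieces, and
`x = ι₁π₁x + ι₂π₂x`). [cite: Deligne1982HodgeCycles, I §3.1 and Prop. 3.4] -/
theorem mem_piece_sum_iff (p q : ℤ) (x : ℂ ⊗[ℚ] V) :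
    x ∈ H.piece p q ↔ π₁.toLinearMap.baseChange ℂ x ∈ H₁.piece p q ∧ π₂.toLinearMap.baseChange ℂ x ∈ H₂.piece p q := by
  constructor
  · intro hx
    exact ⟨π₁.map_piece_le p q ⟨x, hx, rfl⟩, π₂.map_piece_le p q ⟨x, hx, rfl⟩⟩
  · rintro ⟨h₁, h₂⟩
    rw [← sum_baseChange ι₁ π₁ ι₂ π₂ hsum x]
    exact Submodule.add_mem _ (ι₁.map_piece_le p q ⟨_, h₁, rfl⟩) (ι₂.map_piece_le p q ⟨_, h₂, rfl⟩)

omit [Module.Finite ℚ V] [HodgeTensorFacts.{u, u}] in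
include hπι₁ hπι₂ hsum in
/-- **Dimensions add for a blockwise subspace**: if membership in `S ≤ V_ℂ` is tested by `π₁,ℂ x ∈ S₁`, `π₂,ℂ x ∈ S₂`, then
`S ≅ S₁ × S₂` and `dim S = dim S₁ + dim S₂`. [folklore] -/
private theorem finrank_eq_add_of_blockwise (S : Submodule ℂ (ℂ ⊗[ℚ] V)) (S₁ : Submodule ℂ (ℂ ⊗[ℚ] V₁)) (S₂ : Submodule ℂ (ℂ ⊗[ℚ] V₂))
    (hS : ∀ x, x ∈ S ↔ π₁.toLinearMap.baseChange ℂ x ∈ S₁ ∧ π₂.toLinearMap.baseChange ℂ x ∈ S₂) :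
    Module.finrank ℂ S = Module.finrank ℂ S₁ + Module.finrank ℂ S₂ := by
  have hπι₁' : π₁.toLinearMap ∘ₗ ι₁.toLinearMap = LinearMap.id := LinearMap.ext hπι₁
  have hπι₂' : π₂.toLinearMap ∘ₗ ι₂.toLinearMap = LinearMap.id := LinearMap.ext hπι₂
  have hπ₁ι₂ : π₁.toLinearMap ∘ₗ ι₂.toLinearMap = 0 := LinearMap.ext (proj₁_incl₂_eq_zero_w ι₁ π₁ ι₂ π₂ hπι₁ hπι₂ hsum)
  have hπ₂ι₁ : π₂.toLinearMap ∘ₗ ι₁.toLinearMap = 0 := LinearMap.ext (proj₂_incl₁_eq_zero_w ι₁ π₁ ι₂ π₂ hπι₁ hπι₂ hsum)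
  have e11 : ∀ y, π₁.toLinearMap.baseChange ℂ (ι₁.toLinearMap.baseChange ℂ y) = y := proj_incl_baseChange hπι₁'
  have e22 : ∀ y, π₂.toLinearMap.baseChange ℂ (ι₂.toLinearMap.baseChange ℂ y) = y := proj_incl_baseChange hπι₂'
  have e12 : ∀ y, π₁.toLinearMap.baseChange ℂ (ι₂.toLinearMap.baseChange ℂ y) = 0 := proj_incl_baseChange_eq_zero hπ₁ι₂
  have e21 : ∀ y, π₂.toLinearMap.baseChange ℂ (ι₁.toLinearMap.baseChange ℂ y) = 0 := proj_incl_baseChange_eq_zero hπ₂ι₁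
  have hmem : ∀ (y₁ : S₁) (y₂ : S₂), ι₁.toLinearMap.baseChange ℂ (y₁ : ℂ ⊗[ℚ] V₁) + ι₂.toLinearMap.baseChange ℂ (y₂ : ℂ ⊗[ℚ] V₂) ∈ S :=
    fun y₁ y₂ => (hS _).2 ⟨by rw [map_add, e11, e12, add_zero]; exact y₁.2, by rw [map_add, e21, e22, zero_add]; exact y₂.2⟩
  let Φ : S ≃ₗ[ℂ] (S₁ × S₂) :=
    { toFun := fun x => (⟨_, ((hS x).1 x.2).1⟩, ⟨_, ((hS x).1 x.2).2⟩)
      map_add' := fun x y => by ext <;> simp [map_add]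
      map_smul' := fun c x => by ext <;> simp [map_smul]
      invFun := fun y => ⟨_, hmem y.1 y.2⟩
      left_inv := fun x => Subtype.ext (sum_baseChange ι₁ π₁ ι₂ π₂ hsum (x : ℂ ⊗[ℚ] V))
      right_inv := fun y => by
        ext
        · change π₁.toLinearMap.baseChange ℂ (ι₁.toLinearMap.baseChange ℂ _ + ι₂.toLinearMap.baseChange ℂ _) = _
          rw [map_add, e11, e12, add_zero]
        · change π₂.toLinearMap.baseChange ℂ (ι₁.toLinearMap.baseChange ℂ _ + ι₂.toLinearMap.baseChange ℂ _) = _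
          rw [map_add, e21, e22, zero_add] }
  rw [Φ.finrank_eq, Module.finrank_prod]

omit [Module.Finite ℚ V] [HodgeTensorFacts.{u, u}] in
include hπι₁ hπι₂ hsum hA₁ hA₂ in
/-- **`dim V_{ℂ,σ} = dim V_{1,ℂ,σ} + dim V_{2,ℂ,σ}`** for the diagonal action. [cite: Deligne1982HodgeCycles, §4 Prop. 4.4] -/
theorem finrank_iInf_eigenspace_sum (σ : E →+* ℂ) :
    Module.finrank ℂ ↥(⨅ e, Module.End.eigenspace ((A.ι e).baseChange ℂ) (σ e)) =
      Module.finrank ℂ ↥(⨅ e, Module.End.eigenspace ((A₁.ι e).baseChange ℂ) (σ e)) +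
        Module.finrank ℂ ↥(⨅ e, Module.End.eigenspace ((A₂.ι e).baseChange ℂ) (σ e)) :=
  finrank_eq_add_of_blockwise ι₁ π₁ ι₂ π₂ hπι₁ hπι₂ hsum _ _ _
    (mem_iInf_eigenspace_sum_iff ι₁ π₁ ι₂ π₂ hπι₁ hπι₂ hsum A₁ A₂ A hA₁ hA₂ σ)

omit [Module.Finite ℚ V] [HodgeTensorFacts.{u, u}] in
include hπι₁ hπι₂ hsum hA₁ hA₂ in
/-- **`dim V^{p,q}_σ(H) = dim V^{p,q}_σ(H₁) + dim V^{p,q}_σ(H₂)`** (eigen-pieces of the diagonal action). [cite: Deligne1982HodgeCycles, §4 Prop. 4.4] -/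
theorem finrank_eigenPiece_sum (σ : E →+* ℂ) (p q : ℤ) :
    Module.finrank ℂ (A.eigenPiece σ p q) = Module.finrank ℂ (A₁.eigenPiece σ p q) + Module.finrank ℂ (A₂.eigenPiece σ p q) := by
  refine finrank_eq_add_of_blockwise ι₁ π₁ ι₂ π₂ hπι₁ hπι₂ hsum _ _ _ fun x => ?_
  simp only [EndAction.eigenPiece, Submodule.mem_inf]
  rw [mem_piece_sum_iff ι₁ π₁ ι₂ π₂ hsum, mem_iInf_eigenspace_sum_iff ι₁ π₁ ι₂ π₂ hπι₁ hπι₂ hsum A₁ A₂ A hA₁ hA₂ σ]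
  tauto

/-! ## §2 The corner operator `X = ι₂ A₂(e₀) π₂` scales the Weil line `⋀ᵈ V_{ℂ,σ}` by `σ(e₀)` -/

omit [HodgeTensorFacts.{u, u}] in
include hπι₁ hπι₂ hsum hA₁ hA₂ in
/-- **The Weil line of the corner operator.**  For `X = ι₂ A₂(e₀) π₂` and `[E:ℚ] = 2`, `dim_ℚ V₂ = 2` (so `V_{2,ℂ,σ}` is a line): the line
`⋀ᵈ V_{ℂ,σ}` (`d = dim V_{ℂ,σ}`) lies in the `σ(e₀)`-eigenspace of `D_{X_ℂ}` — `V_{ℂ,σ} = ι₂ V_{2,ℂ,σ} ⊕ ι₁ V_{1,ℂ,σ}` has a basis of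
`X_ℂ`-eigenvectors with eigenvalues `σ e₀` (once) and `0`. [cite: MoonenZarhin1999LowDim, Thm. 0.1 (4) and §3 (3.1)] [cite: Deligne1982HodgeCycles, §4 Prop. 4.4] -/
theorem weilLine_le_eigenspace_derivation_corner (hE2 : Module.finrank ℚ E = 2) (hV₂ : Module.finrank ℚ V₂ = 2) (e₀ : E)
    (σ : E →+* ℂ) {d : ℕ} (hd : Module.finrank ℂ ↥(⨅ e, Module.End.eigenspace ((A.ι e).baseChange ℂ) (σ e)) = d) :
    LinearMap.range (exteriorPower.map d (⨅ e, Module.End.eigenspace ((A.ι e).baseChange ℂ) (σ e)).subtype) ≤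
      Module.End.eigenspace (derivationExteriorPower ((ι₂.toLinearMap ∘ₗ A₂.ι e₀ ∘ₗ π₂.toLinearMap).baseChange ℂ) d) (σ e₀) := by
  classical
  set N₁ := (⨅ e, Module.End.eigenspace ((A₁.ι e).baseChange ℂ) (σ e)) with hN₁
  set N₂ := (⨅ e, Module.End.eigenspace ((A₂.ι e).baseChange ℂ) (σ e)) with hN₂
  set N := (⨅ e, Module.End.eigenspace ((A.ι e).baseChange ℂ) (σ e)) with hN
  have h2 : Module.finrank ℂ N₂ = 1 := by rw [hN₂, A₂.finrank_iInf_eigenspace_of_finrank_eq_two hE2 σ, hV₂]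
  have hadd := finrank_iInf_eigenspace_sum ι₁ π₁ ι₂ π₂ hπι₁ hπι₂ hsum A₁ A₂ A hA₁ hA₂ σ
  rw [← hN, ← hN₁, ← hN₂, hd, h2] at hadd
  -- bases: `u₀` spanning `N₂`, `b` a basis of `N₁`
  set d₁ := Module.finrank ℂ N₁ with hd₁
  obtain ⟨u₀, hu₀⟩ : ∃ u₀ : N₂, u₀ ≠ 0 := by
    by_contra h
    push Not at h
    haveI : Subsingleton N₂ := ⟨fun a b => by rw [h a, h b]⟩
    have : Module.finrank ℂ N₂ = 0 := Module.finrank_zero_of_subsingleton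
    omega
  let b : Module.Basis (Fin d₁) ℂ N₁ := Module.finBasisOfFinrankEq ℂ N₁ rfl
  -- the family `v = (ι₂ u₀, ι₁ b₀, …, ι₁ b_{d₁-1})`
  have hdd : d₁ + 1 = d := by omega
  subst hdd
  let v : Fin (d₁ + 1) → ℂ ⊗[ℚ] V :=
    Fin.cons (ι₂.toLinearMap.baseChange ℂ (u₀ : ℂ ⊗[ℚ] V₂)) (fun j => ι₁.toLinearMap.baseChange ℂ (b j : ℂ ⊗[ℚ] V₁))
  let c : Fin (d₁ + 1) → ℂ := Fin.cons (σ e₀) (fun _ => 0)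
  have hπι₁' : π₁.toLinearMap ∘ₗ ι₁.toLinearMap = LinearMap.id := LinearMap.ext hπι₁
  have hπι₂' : π₂.toLinearMap ∘ₗ ι₂.toLinearMap = LinearMap.id := LinearMap.ext hπι₂
  have hπ₁ι₂ : π₁.toLinearMap ∘ₗ ι₂.toLinearMap = 0 := LinearMap.ext (proj₁_incl₂_eq_zero_w ι₁ π₁ ι₂ π₂ hπι₁ hπι₂ hsum)
  have hπ₂ι₁ : π₂.toLinearMap ∘ₗ ι₁.toLinearMap = 0 := LinearMap.ext (proj₂_incl₁_eq_zero_w ι₁ π₁ ι₂ π₂ hπι₁ hπι₂ hsum)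
  have e11 : ∀ y, π₁.toLinearMap.baseChange ℂ (ι₁.toLinearMap.baseChange ℂ y) = y := proj_incl_baseChange hπι₁'
  have e22 : ∀ y, π₂.toLinearMap.baseChange ℂ (ι₂.toLinearMap.baseChange ℂ y) = y := proj_incl_baseChange hπι₂'
  have e12 : ∀ y, π₁.toLinearMap.baseChange ℂ (ι₂.toLinearMap.baseChange ℂ y) = 0 := proj_incl_baseChange_eq_zero hπ₁ι₂
  have e21 : ∀ y, π₂.toLinearMap.baseChange ℂ (ι₁.toLinearMap.baseChange ℂ y) = 0 := proj_incl_baseChange_eq_zero hπ₂ι₁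
  -- the family lies in `N`
  have hvN : ∀ i, v i ∈ N := by
    intro i
    refine Fin.cases ?_ (fun j => ?_) i
    · change ι₂.toLinearMap.baseChange ℂ (u₀ : ℂ ⊗[ℚ] V₂) ∈ N
      rw [hN, mem_iInf_eigenspace_sum_iff ι₁ π₁ ι₂ π₂ hπι₁ hπι₂ hsum A₁ A₂ A hA₁ hA₂ σ, e12, e22]
      exact ⟨Submodule.zero_mem _, u₀.2⟩
    · change ι₁.toLinearMap.baseChange ℂ (b j : ℂ ⊗[ℚ] V₁) ∈ N
      rw [hN, mem_iInf_eigenspace_sum_iff ι₁ π₁ ι₂ π₂ hπι₁ hπι₂ hsum A₁ A₂ A hA₁ hA₂ σ, e11, e21]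
      exact ⟨(b j).2, Submodule.zero_mem _⟩
  -- the family is linearly independent
  have hli₁ : LinearIndependent ℂ (fun j => ι₁.toLinearMap.baseChange ℂ (b j : ℂ ⊗[ℚ] V₁)) := by
    have h := (b.linearIndependent.map' N₁.subtype (Submodule.ker_subtype N₁)).map'
      (ι₁.toLinearMap.baseChange ℂ) (LinearMap.ker_eq_bot.2 (Function.LeftInverse.injective e11))
    exact h
  have hli : LinearIndependent ℂ v := by
    refine linearIndependent_finCons.2 ⟨hli₁, fun hmem => hu₀ ?_⟩
    -- `ι₂ u₀ ∈ span (ι₁ b_j)` forces `u₀ = π₂ ι₂ u₀ = 0`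
    have h0 : π₂.toLinearMap.baseChange ℂ (ι₂.toLinearMap.baseChange ℂ (u₀ : ℂ ⊗[ℚ] V₂)) = 0 := by
      have hle : Submodule.span ℂ (Set.range fun j => ι₁.toLinearMap.baseChange ℂ (b j : ℂ ⊗[ℚ] V₁)) ≤
          LinearMap.ker (π₂.toLinearMap.baseChange ℂ) := by
        rw [Submodule.span_le]
        rintro _ ⟨j, rfl⟩
        rw [SetLike.mem_coe, LinearMap.mem_ker, e21]
      exact hle hmem
    rw [e22] at h0
    exact Subtype.ext h0
  -- eigenvalues of `X_ℂ` on the family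
  set X := ι₂.toLinearMap ∘ₗ A₂.ι e₀ ∘ₗ π₂.toLinearMap with hX
  have hXv : ∀ i, X.baseChange ℂ (v i) = c i • v i := by
    intro i
    refine Fin.cases ?_ (fun j => ?_) i
    · change X.baseChange ℂ (ι₂.toLinearMap.baseChange ℂ (u₀ : ℂ ⊗[ℚ] V₂)) = σ e₀ • ι₂.toLinearMap.baseChange ℂ (u₀ : ℂ ⊗[ℚ] V₂)
      have hu : (A₂.ι e₀).baseChange ℂ (u₀ : ℂ ⊗[ℚ] V₂) = σ e₀ • (u₀ : ℂ ⊗[ℚ] V₂) :=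
        Module.End.mem_eigenspace_iff.1 ((Submodule.mem_iInf _).1 u₀.2 e₀)
      rw [hX, LinearMap.baseChange_comp, LinearMap.baseChange_comp, LinearMap.comp_apply, LinearMap.comp_apply, e22, hu, map_smul]
    · change X.baseChange ℂ (ι₁.toLinearMap.baseChange ℂ (b j : ℂ ⊗[ℚ] V₁)) = (0 : ℂ) • ι₁.toLinearMap.baseChange ℂ (b j : ℂ ⊗[ℚ] V₁)
      rw [hX, LinearMap.baseChange_comp, LinearMap.baseChange_comp, LinearMap.comp_apply, LinearMap.comp_apply, e21, map_zero,
        map_zero, zero_smul]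
  have hsumc : ∑ i, c i = σ e₀ := by
    rw [Fin.sum_univ_succ]
    simp [c]
  rw [← hsumc]
  haveI : Module.Finite ℂ N := inferInstance
  exact range_exteriorPower_map_subtype_le_eigenspace_of_eigenbasis N hd v hli hvN _ c hXv

end General

/-! ## §3 Weil type: the corner operator is not in `𝔥(H)`, and `dim 𝔥(H) < dim 𝔥(H₁) + dim 𝔥(H₂)` -/

section WeightOne

variable {H₁ : HodgeStructure V₁ 1} {H₂ : HodgeStructure V₂ 1} {H : HodgeStructure V 1}
  (ι₁ : Hom H₁ H) (π₁ : Hom H H₁) (ι₂ : Hom H₂ H) (π₂ : Hom H H₂)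
  (hπι₁ : ∀ v, π₁.toLinearMap (ι₁.toLinearMap v) = v) (hπι₂ : ∀ v, π₂.toLinearMap (ι₂.toLinearMap v) = v)
  (hsum : ∀ v, ι₁.toLinearMap (π₁.toLinearMap v) + ι₂.toLinearMap (π₂.toLinearMap v) = v)
  {E : Type*} [Field E] [NumberField E] (A₁ : EndAction H₁ E) (A₂ : EndAction H₂ E) (A : EndAction H E)
  (hA₁ : ∀ e, A.ι e ∘ₗ ι₁.toLinearMap = ι₁.toLinearMap ∘ₗ A₁.ι e) (hA₂ : ∀ e, A.ι e ∘ₗ ι₂.toLinearMap = ι₂.toLinearMap ∘ₗ A₂.ι e)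
  (heff : H.IsEffective) (hE2 : Module.finrank ℚ E = 2) (hV₂ : Module.finrank ℚ V₂ = 2)
  (hW : ∀ σ : E →+* ℂ, 2 * (A₁.multiplicity σ + A₂.multiplicity σ) = Module.finrank ℚ V / 2) {e₀ : E} (he₀ : e₀ ≠ 0)

include hπι₁ hπι₂ hsum hA₁ hA₂ heff hE2 hV₂ hW he₀ in
/-- **The corner of `𝔥(H₂)` is missing from `𝔥(H₁ ⊕ H₂)` under Weil type.**  If the total action of the quadratic field `E` on
`H ≅ H₁ ⊕ H₂` (effective, weight one, `dim_ℚ V₂ = 2`) is OF WEIL TYPE — `2(n_σ(H₁) + n_σ(H₂)) = dim_ℚ V / 2` for every `σ` — then for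
every `e₀ ≠ 0` the operator `ι₂ A₂(e₀) π₂` («`e₀` on `H₂`, `0` on `H₁`») is NOT in `𝔥(H)`: its derivation scales the Weil lines by
`σ(e₀) ≠ 0` (§2) while `𝔥(H)` kills the Weil classes, which are Hodge classes (`not_mem_hodgeLie_of_weilType_of_derivation_eigenvalues`).
[cite: MoonenZarhin1999LowDim, Thm. 0.1 (4) and §3 (3.1)] [cite: Deligne1982HodgeCycles, §4 Prop. 4.4] -/
theorem corner_not_mem_hodgeLie_of_weilType : ι₂.toLinearMap ∘ₗ A₂.ι e₀ ∘ₗ π₂.toLinearMap ∉ H.hodgeLie := by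
  obtain ⟨σ₀⟩ := (inferInstance : Nonempty (E →+* ℂ))
  set d := Module.finrank ℚ V / 2 with hddef
  have hdim : ∀ σ : E →+* ℂ, Module.finrank ℂ ↥(⨅ e, Module.End.eigenspace ((A.ι e).baseChange ℂ) (σ e)) = d :=
    fun σ => A.finrank_iInf_eigenspace_of_finrank_eq_two hE2 σ
  have h2 : ∀ σ : E →+* ℂ, Module.finrank ℂ ↥(⨅ e, Module.End.eigenspace ((A₂.ι e).baseChange ℂ) (σ e)) = 1 := fun σ => by
    rw [A₂.finrank_iInf_eigenspace_of_finrank_eq_two hE2 σ, hV₂]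
  have hd : 0 < d := by
    have h := finrank_iInf_eigenspace_sum ι₁ π₁ ι₂ π₂ hπι₁ hπι₂ hsum A₁ A₂ A hA₁ hA₂ σ₀
    rw [hdim, h2] at h
    omega
  have hW' : ∀ σ : E →+* ℂ, 2 * A.multiplicity σ = d := fun σ => by
    rw [EndAction.multiplicity, finrank_eigenPiece_sum ι₁ π₁ ι₂ π₂ hπι₁ hπι₂ hsum A₁ A₂ A hA₁ hA₂ σ 1 0]
    exact hW σ
  refine not_mem_hodgeLie_of_weilType_of_derivation_eigenvalues A heff hE2 hd hdim hW' _ (fun σ => σ e₀)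
    (fun σ => (map_ne_zero_iff σ σ.injective).2 he₀) fun σ => ?_
  exact weilLine_le_eigenspace_derivation_corner ι₁ π₁ ι₂ π₂ hπι₁ hπι₂ hsum A₁ A₂ A hA₁ hA₂ hE2 hV₂ e₀ σ (hdim σ)

include hπι₁ hπι₂ hsum hA₁ hA₂ heff hE2 hV₂ hW he₀ in
/-- **`dim 𝔥(H₁ ⊕ H₂) < dim 𝔥(H₁) + dim 𝔥(H₂)` under Weil type, when `A₂(e₀) ∈ 𝔥(H₂)`** (e.g. `e₀` the imaginary generator of the CM field of
an elliptic curve: `𝔥(H¹E) = ℚ χ^*`).  The block map `X ↦ (π₁Xι₁, π₂Xι₂)`, `𝔥(H) → 𝔥(H₁) × 𝔥(H₂)`, is injective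
(`eq_sum_blocks_of_mem_hodgeLie`); were the dimensions equal it would be onto, and the preimage of `(0, A₂(e₀))` would be the corner
`ι₂ A₂(e₀) π₂ ∈ 𝔥(H)`, excluded by `corner_not_mem_hodgeLie_of_weilType`.  Moonen–Zarhin: «`Hg(X × E) ≠ Hg(X) × Hg(E)`» in case (a) of
Thm. 0.1 (4). [cite: MoonenZarhin1999LowDim, Thm. 0.1 (4) and §3 (3.1)] [cite: Deligne1982HodgeCycles, I §3.1 and Prop. 3.4] -/
theorem finrank_hodgeLie_lt_add_of_weilType (hmem : A₂.ι e₀ ∈ H₂.hodgeLie) :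
    Module.finrank ℚ H.hodgeLie < Module.finrank ℚ H₁.hodgeLie + Module.finrank ℚ H₂.hodgeLie := by
  -- the injective block map `X ↦ (π₁ X ι₁, π₂ X ι₂)`
  let r₁ : Module.End ℚ V →ₗ[ℚ] Module.End ℚ V₁ :=
    (LinearMap.llcomp ℚ V₁ V V₁ π₁.toLinearMap).comp (LinearMap.lcomp ℚ V ι₁.toLinearMap)
  let r₂ : Module.End ℚ V →ₗ[ℚ] Module.End ℚ V₂ :=
    (LinearMap.llcomp ℚ V₂ V V₂ π₂.toLinearMap).comp (LinearMap.lcomp ℚ V ι₂.toLinearMap)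
  have hr₁ : ∀ X, r₁ X = π₁.toLinearMap ∘ₗ X ∘ₗ ι₁.toLinearMap := fun X => rfl
  have hr₂ : ∀ X, r₂ X = π₂.toLinearMap ∘ₗ X ∘ₗ ι₂.toLinearMap := fun X => rfl
  let B : H.hodgeLie →ₗ[ℚ] (H₁.hodgeLie × H₂.hodgeLie) :=
    LinearMap.prod
      (LinearMap.codRestrict H₁.hodgeLie (r₁.comp H.hodgeLie.subtype) fun X => by
        rw [LinearMap.comp_apply, Submodule.subtype_apply, hr₁]; exact comp_mem_hodgeLie_of_retract ι₁ π₁ hπι₁ X.2)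
      (LinearMap.codRestrict H₂.hodgeLie (r₂.comp H.hodgeLie.subtype) fun X => by
        rw [LinearMap.comp_apply, Submodule.subtype_apply, hr₂]; exact comp_mem_hodgeLie_of_retract ι₂ π₂ hπι₂ X.2)
  have hB1 : ∀ X : H.hodgeLie, ((B X).1 : Module.End ℚ V₁) = π₁.toLinearMap ∘ₗ (X : Module.End ℚ V) ∘ₗ ι₁.toLinearMap := fun X => rfl
  have hB2 : ∀ X : H.hodgeLie, ((B X).2 : Module.End ℚ V₂) = π₂.toLinearMap ∘ₗ (X : Module.End ℚ V) ∘ₗ ι₂.toLinearMap := fun X => rfl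
  have hBinj : Function.Injective B := by
    intro X Y hXY
    apply Subtype.ext
    have h1 : π₁.toLinearMap ∘ₗ (X : Module.End ℚ V) ∘ₗ ι₁.toLinearMap = π₁.toLinearMap ∘ₗ (Y : Module.End ℚ V) ∘ₗ ι₁.toLinearMap := by
      rw [← hB1, ← hB1, hXY]
    have h2 : π₂.toLinearMap ∘ₗ (X : Module.End ℚ V) ∘ₗ ι₂.toLinearMap = π₂.toLinearMap ∘ₗ (Y : Module.End ℚ V) ∘ₗ ι₂.toLinearMap := by
      rw [← hB2, ← hB2, hXY]
    rw [eq_sum_blocks_of_mem_hodgeLie ι₁ π₁ ι₂ π₂ hπι₁ hπι₂ hsum X.2, eq_sum_blocks_of_mem_hodgeLie ι₁ π₁ ι₂ π₂ hπι₁ hπι₂ hsum Y.2,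
      h1, h2]
  have hle : Module.finrank ℚ H.hodgeLie ≤ Module.finrank ℚ H₁.hodgeLie + Module.finrank ℚ H₂.hodgeLie := by
    rw [← Module.finrank_prod]
    exact LinearMap.finrank_le_finrank_of_injective hBinj
  refine lt_of_le_of_ne hle fun heq => ?_
  -- equal dimensions: the block map is onto, and `(0, A₂(e₀))` has a preimage — the forbidden corner
  have hBsurj : Function.Surjective B := by
    have hdim : Module.finrank ℚ H.hodgeLie = Module.finrank ℚ (H₁.hodgeLie × H₂.hodgeLie) := by rw [Module.finrank_prod, heq]
    exact (LinearMap.injective_iff_surjective_of_finrank_eq_finrank hdim).1 hBinj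
  obtain ⟨Z, hZ⟩ := hBsurj (0, ⟨A₂.ι e₀, hmem⟩)
  have hZ1 : π₁.toLinearMap ∘ₗ (Z : Module.End ℚ V) ∘ₗ ι₁.toLinearMap = 0 := by
    rw [← hB1, hZ]; rfl
  have hZ2 : π₂.toLinearMap ∘ₗ (Z : Module.End ℚ V) ∘ₗ ι₂.toLinearMap = A₂.ι e₀ := by
    rw [← hB2, hZ]
  have hZeq : (Z : Module.End ℚ V) = ι₂.toLinearMap ∘ₗ A₂.ι e₀ ∘ₗ π₂.toLinearMap := by
    rw [eq_sum_blocks_of_mem_hodgeLie ι₁ π₁ ι₂ π₂ hπι₁ hπι₂ hsum Z.2, hZ1, hZ2, LinearMap.zero_comp, LinearMap.comp_zero, zero_add]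
  exact corner_not_mem_hodgeLie_of_weilType ι₁ π₁ ι₂ π₂ hπι₁ hπι₂ hsum A₁ A₂ A hA₁ hA₂ heff hE2 hV₂ hW he₀ (hZeq ▸ Z.2)

end WeightOne

end HodgeStructure

end Literature.AlgebraicGeometry.Motives

end
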